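import Literature.AlgebraicGeometry.Motives.AbelianVarietyPermutationPowerIsotypical
import Literature.RepresentationTheory.FiniteGroups.PermutationModuleIsotypicalMultiplicity
import HarnessLib

/-!
# The exponents of the isotypical decomposition of a permutation power are the isotypical multiplicities of the
# permutation module: `B_W(A^S) ∼ A^{dim (e_W · ℂ[S])}`, `A^S ∼ ∏_W A^{dim (e_W · ℂ[S])}`

`Motives/AbelianVarietyPermutationPowerIsotypical` computes the isotypical components `B_W = Im u_W` of a permutation power
`A^S` (`u_W = Σ_g c_W(g) ρ(g)`, `|G| e_W = Σ_g c_W(g) g`) through the integer `Σ_g c_W(g) |S^g|` and an auxiliary `m` with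
`|G| · m = Σ_g c_W(g) |S^g|`; `RepresentationTheory/FiniteGroups/PermutationModuleIsotypicalMultiplicity` identifies that integer:
`Σ_g c_W(g) |S^g| = |G| · dim_ℂ (e_W · ℂ[S])`, the dimension of the `W`-isotypical component of the permutation representation
(Serre §2.6 Thm. 8 (ii): the trace of the projector `p_i` is `dim V_i`).  This file substitutes one into the other, so that no
auxiliary integer remains:

* (any field) `rk_ℤ Hom(B_W(A^S), B) = dim (e_W ℂ[S]) · rk_ℤ Hom(A, B)`, `dim B_W(A^S) = dim (e_W ℂ[S]) · dim A`,
  `B_W(A^S) = 0 ⟺ dim A = 0 ∨ e_W ℂ[S] = 0` ("`dim B = 0` if and only if `⟨ρ, W⟩ = 0`"), `Σ_W dim (e_W ℂ[S]) = |S|`;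
* (perfect field) **`B_W(A^S) ∼ A^{dim (e_W ℂ[S])}`** and **`A^S ∼ ∏_{W ∈ Irr_ℚ(G)} A^{dim (e_W ℂ[S])}`** — the isotypical
  decomposition of `A ⊗ ℤ[S]` is `A ⊗` (the isotypical decomposition of `ℚ[S]`), up to isogeny.

The multiplicity is written out as `finrank ℂ (range (e_W | ℂ[S]))`, `e_W` acting on Mathlib's permutation module
`Representation.ofMulAction ℂ G S` through `ℚ[G] → ℂ[G]`; no definition is introduced.

## References

* [LangeRodriguez2022] H. Lange, R. E. Rodríguez, *Decomposition of Jacobians by Prym Varieties*, LNM 2310 (2022), §2.9.1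
  Thm. 2.9.1 and Prop. 2.9.3 (PDF pp. 43, 46).
* [SerreLinearRepresentations1977] J.-P. Serre, *Linear Representations of Finite Groups*, GTM 42 (1977), §2.3 Ex. 2.2, §2.6 Thm. 8.
* [LangeRecillas2004] H. Lange, S. Recillas, *Abelian varieties with group action*, J. reine angew. Math. 575 (2004), §1 Prop. 1.1.
-/

noncomputable section

open CategoryTheory CategoryTheory.Limits MulAction
open Literature.NumberTheory.DiophantineGeometry
open Literature.RepresentationTheory.FiniteGroups

universe u

namespace Literature.AlgebraicGeometry.Motives

namespace AbelianVariety

variable {K : Type u} [Field K] {A : AbelianVariety K} {S : Type} [Fintype S] (b : Bicone (fun _ : S ↦ A))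
  {G : Type} [Group G] [Fintype G] [MulAction G S] (ρ : G →* End b.pt)
  {c : ratCharIdempotents G → G → ℤ}
  (hc : ∀ e : ratCharIdempotents G,
    (Fintype.card G : ℚ) • (e : MonoidAlgebra ℚ G) = ∑ g, (c e g : ℚ) • MonoidAlgebra.of ℚ G g)
  {u : ratCharIdempotents G → (b.pt ⟶ b.pt)} (hu : ∀ e, End.of (u e) = ∑ g, c e g • ρ g)

include hc in
/-- **`|G| · dim_ℂ (e_W · ℂ[S]) = Σ_g c_W(g) |S^g|`** for every member of the family `{e_W}` with its integral coefficients `c_W`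
(the prequel's `mul_finrank_range_ofMulAction_eq_sum`; `|S^g| = Set.ncard (fixedBy S g)`).
[cite: SerreLinearRepresentations1977, §2.6 Thm. 8 (ii) and §2.3 Ex. 2.2] [cite: LangeRodriguez2022, §2.8 (2.23) (PDF p. 40)] -/
theorem card_mul_finrank_range_ratCharIdempotents_eq (e : ratCharIdempotents G) :
    (Fintype.card G : ℤ) * Module.finrank ℂ (LinearMap.range ((Representation.ofMulAction ℂ G S).asAlgebraHom
        (MonoidAlgebra.mapRingHom G (algebraMap ℚ ℂ) (e : MonoidAlgebra ℚ G)))) =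
      ∑ g, c e g * ((MulAction.fixedBy S g).ncard : ℤ) := by
  rw [mul_finrank_range_ofMulAction_eq_sum (completeOrthogonalIdempotents_ratCharIdempotents.idem e) (hc e)]
  simp_rw [Nat.card_coe_set_eq]

omit [MulAction G S] in
/-- **`Σ_{W ∈ Irr_ℚ(G)} dim_ℂ (e_W · ℂ[S]) = |S|`** (the family `{e_W}` is complete).
[cite: SerreLinearRepresentations1977, §2.6 Thm. 8 (i), (ii)] [cite: LangeRodriguez2022, §2.8 (2.22) (PDF p. 40)] -/
theorem sum_finrank_range_ratCharIdempotents_eq_card [MulAction G S] :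
    ∑ e : ratCharIdempotents G, Module.finrank ℂ (LinearMap.range ((Representation.ofMulAction ℂ G S).asAlgebraHom
        (MonoidAlgebra.mapRingHom G (algebraMap ℚ ℂ) (e : MonoidAlgebra ℚ G)))) = Fintype.card S :=
  sum_finrank_range_ofMulAction_eq_card completeOrthogonalIdempotents_ratCharIdempotents

include hc hu

/-- **`rk_ℤ Hom(B_W(A^S), B) = dim (e_W ℂ[S]) · rk_ℤ Hom(A, B)`** for every abelian variety `B` (any field).
[cite: LangeRodriguez2022, §2.9.1 Thm. 2.9.1 and Prop. 2.9.3 (PDF pp. 43, 46)] [cite: SerreLinearRepresentations1977, §2.6 Thm. 8 (ii)] -/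
theorem finrank_hom_isotypical_permAction_eq_finrank_mul (B : AbelianVariety K) (hb : ∑ s, b.π s ≫ b.ι s = 𝟙 b.pt)
    (hρ : ∀ (g : G) (s : S), b.ι s ≫ End.asHom (ρ g) = b.ι (g • s)) (e : ratCharIdempotents G) :
    Module.finrank ℤ (image (u e) ⟶ B) =
      Module.finrank ℂ (LinearMap.range ((Representation.ofMulAction ℂ G S).asAlgebraHom
        (MonoidAlgebra.mapRingHom G (algebraMap ℚ ℂ) (e : MonoidAlgebra ℚ G)))) * Module.finrank ℤ (A ⟶ B) :=
  finrank_hom_isotypical_permAction_eq b ρ hc hu B hb hρ e (card_mul_finrank_range_ratCharIdempotents_eq hc e)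

/-- **`dim B_W(A^S) = dim (e_W ℂ[S]) · dim A`** (any field): Lange–Rodríguez's "`dim B_i = ½ ⟨ρ_r, W_i⟩`" for the permutation
power, whose rational representation is `ρ_r = 2 dim A · ℚ[S]`. [cite: LangeRodriguez2022, §2.9.1 Prop. 2.9.3 (PDF p. 46)]
[cite: SerreLinearRepresentations1977, §2.6 Thm. 8 (ii)] -/
theorem dim_isotypical_permAction_eq_finrank_mul (hb : ∑ s, b.π s ≫ b.ι s = 𝟙 b.pt)
    (hρ : ∀ (g : G) (s : S), b.ι s ≫ End.asHom (ρ g) = b.ι (g • s)) (e : ratCharIdempotents G) :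
    (image (u e)).dim =
      Module.finrank ℂ (LinearMap.range ((Representation.ofMulAction ℂ G S).asAlgebraHom
        (MonoidAlgebra.mapRingHom G (algebraMap ℚ ℂ) (e : MonoidAlgebra ℚ G)))) * A.dim :=
  dim_isotypical_permAction_eq b ρ hc hu hb hρ e (card_mul_finrank_range_ratCharIdempotents_eq hc e)

/-- **VANISHING: `B_W(A^S) = 0 ⟺ dim A = 0 ∨ e_W ℂ[S] = 0`** — for `A ≠ 0` the `W`-component of `A ⊗ ℤ[S]` vanishes exactly
when `W` does not occur in the permutation representation ("`dim B = 0` if and only if `⟨ρ, W⟩ = 0`").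
[cite: LangeRodriguez2022, §2.9.1 Thm. 2.9.1 and Prop. 2.9.3 (ii) (PDF pp. 43, 46)] -/
theorem dim_isotypical_permAction_eq_zero_iff_finrank (hb : ∑ s, b.π s ≫ b.ι s = 𝟙 b.pt)
    (hρ : ∀ (g : G) (s : S), b.ι s ≫ End.asHom (ρ g) = b.ι (g • s)) (e : ratCharIdempotents G) :
    (image (u e)).dim = 0 ↔ A.dim = 0 ∨
      Module.finrank ℂ (LinearMap.range ((Representation.ofMulAction ℂ G S).asAlgebraHom
        (MonoidAlgebra.mapRingHom G (algebraMap ℚ ℂ) (e : MonoidAlgebra ℚ G)))) = 0 := by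
  rw [dim_isotypical_permAction_eq_finrank_mul b ρ hc hu hb hρ e, mul_eq_zero, or_comm]

section Isogeny

variable [PerfectField K]

/-- **`B_W(A^S) ∼ A^{dim (e_W ℂ[S])}`** over a perfect field: the isotypical component of `W` in `A ⊗ ℤ[S]` is, up to isogeny,
`A` tensored with the `W`-isotypical component of the permutation lattice.
[cite: LangeRodriguez2022, §2.9.1 Thm. 2.9.1 and Prop. 2.9.3 (PDF pp. 43, 46)] [cite: LangeRecillas2004, §1 Prop. 1.1]
[cite: SerreLinearRepresentations1977, §2.6 Thm. 8 (ii)] -/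
theorem isIsogenous_isotypical_permAction_biproduct_finrank (hb : ∑ s, b.π s ≫ b.ι s = 𝟙 b.pt)
    (hρ : ∀ (g : G) (s : S), b.ι s ≫ End.asHom (ρ g) = b.ι (g • s)) (e : ratCharIdempotents G) :
    IsIsogenous (image (u e)) (⨁ fun _ : Fin (Module.finrank ℂ (LinearMap.range
      ((Representation.ofMulAction ℂ G S).asAlgebraHom (MonoidAlgebra.mapRingHom G (algebraMap ℚ ℂ) (e : MonoidAlgebra ℚ G))))) ↦ A) :=
  isIsogenous_isotypical_permAction_biproduct b ρ hc hu hb hρ e (card_mul_finrank_range_ratCharIdempotents_eq hc e)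

/-- **The isotypical decomposition of a permutation power, explicitly: `A^S ∼ ∏_{W ∈ Irr_ℚ(G)} A^{dim (e_W ℂ[S])}`** over a
perfect field. [cite: LangeRodriguez2022, §2.9.1 Thm. 2.9.1 (b) and Prop. 2.9.3 (PDF pp. 43, 46)] [cite: LangeRecillas2004, §1 Prop. 1.1]
[cite: SerreLinearRepresentations1977, §2.6 Thm. 8] -/
theorem isIsogenous_permPower_biproduct_isotypical_finrank (hb : ∑ s, b.π s ≫ b.ι s = 𝟙 b.pt)
    (hρ : ∀ (g : G) (s : S), b.ι s ≫ End.asHom (ρ g) = b.ι (g • s)) :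
    IsIsogenous b.pt (⨁ fun e : ratCharIdempotents G ↦ ⨁ fun _ : Fin (Module.finrank ℂ (LinearMap.range
      ((Representation.ofMulAction ℂ G S).asAlgebraHom (MonoidAlgebra.mapRingHom G (algebraMap ℚ ℂ) (e : MonoidAlgebra ℚ G))))) ↦ A) :=
  isIsogenous_permPower_biproduct_isotypical b ρ hc hu hb hρ fun e ↦ card_mul_finrank_range_ratCharIdempotents_eq hc e

end Isogeny

end AbelianVariety

end Literature.AlgebraicGeometry.Motives
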